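import Mathlib
import HarnessLib
import Summits.ValiantsHypothesis.ValiantsHypothesis.Theses.MonotoneRestoration
import Literature.Computability.AlgebraicComplexity.ArithCircuit
import Literature.Computability.AlgebraicComplexity.ArithCircuitProofs
import Literature.Computability.AlgebraicComplexity.MonotoneStructure
import Literature.Computability.AlgebraicComplexity.PermanentIrreducible
import Literature.ModelTheory.FiniteModelTheory.CkEquiv
import Summits.ValiantsHypothesis.ValiantsHypothesis.Theorems.MonotoneRestorationMonotoneRestorationQPCosetCount
import Summits.ValiantsHypothesis.ValiantsHypothesis.Theorems.MonotoneRestorationMonotoneRestorationQPSymmetricLB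
import Summits.ValiantsHypothesis.ValiantsHypothesis.Theorems.MonotoneRestorationMonotoneRestorationQPSupportSymmetrisation
import Summits.ValiantsHypothesis.ValiantsHypothesis.Theorems.MonotoneRestorationMonotoneRestorationQPSparseRegime
import Summits.ValiantsHypothesis.ValiantsHypothesis.Theorems.MonotoneRestorationMonotoneRestorationQPBeta
import Literature.Computability.AlgebraicComplexity.SymmetricArithCircuit
import Literature.Computability.AlgebraicComplexity.DawarWilsenach2025Proofs
import Literature.GroupTheory.PermutationGroups.SmallIndexSubgroups
import Summits.ValiantsHypothesis.ValiantsHypothesis.Theorems.MonotoneRestorationQP.Negative.LoadBearing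
import Summits.ValiantsHypothesis.ValiantsHypothesis.Theorems.MonotoneRestorationMonotoneRestorationQPPermSupportCount

/-! # TTRL-lite variant V19161 of `MonotoneRestorationQP` / `stub_gateSupport` (stmt-ValiantsHypothesis-15886)

Machine-generated helper (proved); move `lemma_proposal`, op `llm`: input-gate case of a direct
proof — a variable gate `x_p` is fixed by every automorphism over a permutation fixing `p.1` and
`p.2` (labels are injective on input gates), i.e. `{p.1, p.2}` supports an input gate.
See docs/architecture/ttrl-lite.md. -/

namespace Summit.ValiantsHypothesis.ValiantsHypothesis.Theorems

open Summit.ValiantsHypothesis.ValiantsHypothesis.Theses.MonotoneRestoration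
open Literature.Computability.AlgebraicComplexity

/-- TTRL-lite variant V19161 (lemma_proposal `llm`) of `stub_gateSupport`
(stmt-ValiantsHypothesis-15886): an automorphism `π` extending a permutation `ρ` that fixes both
indices of `p` fixes the input gate labelled `x_p` (its label `var (ρ • p) = var p` is unchanged and
labels are injective on input gates); machine-found, kernel-checked. -/
theorem stub_gateSupport_var19161 :
    ∀ (n : ℕ) (K : Type) (G : Type) (C : LabelledArithCircuit K (Fin n × Fin n) Unit G) (g : G)
      (p : Fin n × Fin n) (ρ : Equiv.Perm (Fin n)) (π : Equiv.Perm G),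
      C.label g = CircuitLabel.var p → C.IsAutomorphismExtending ρ π → ρ p.1 = p.1 →
        ρ p.2 = p.2 → π g = g := by
  intro n K G C g p ρ π hg h h1 h2
  have hlab : C.label (π g) = CircuitLabel.var p := by
    rw [h.label_apply, hg, CircuitLabel.smul_var]
    obtain ⟨p1, p2⟩ := p
    simp only [Prod.smul_mk, Equiv.Perm.smul_def] at h1 h2 ⊢
    rw [h1, h2]
  exact C.eq_of_label_eq (π g) g (by rw [hlab]; exact CircuitLabel.isInput_var p) (by rw [hlab, hg])

end Summit.ValiantsHypothesis.ValiantsHypothesis.Theorems
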